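import Literature.NumberTheory.EllipticCurves.DeuringHeckeContinuationHolds
import Literature.NumberTheory.EllipticCurves.BSDSelmerCMPConverseProofs
import HarnessLib

/-!
# Deuring's theorem over `ℚ`, every CM `j`: `L(E, s)` is entire for EVERY CM elliptic curve over `ℚ`; `ord_{s=1} L(E/K, s) = 2 ord_{s=1} L(E, s)`
# for the CM field `K`; and the two forms of Burungale–Tian's rank-zero `p`-converse are equivalent — all below the PROVED Deuring–Hecke leaf

Topic `Literature/NumberTheory/EllipticCurves`, namespace `Literature.NumberTheory.EllipticCurves.DeuringHecke` (sequel to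
`DeuringHeckeContinuationHolds`).  THEOREMS ONLY.  The tree's theorems «below Deuring–Hecke» (`BSDSelmerCMPConverseProofs`:
`hasEntireLFunction_of_hasCM_of_deuringHecke`, `analyticRank_baseChange_cmField_of_deuringHecke`,
`burungaleTian_…_of_cmField_of_deuringHecke`, `cmField_form_of_burungaleTian_of_deuringHecke`, `L_one_ne_zero_of_burungaleTian_of_deuringHecke`)
carried the leaf `hH : hasEntireLFunction_of_j_mem_maximalCMJInvariants` as a hypothesis; it is now the theorem
`DeuringHecke.hasEntireLFunction_of_j_mem_maximalCMJInvariants_holds` (Hecke's theta series of the nine class-number-one orders in the kernel),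
so each has an `hH`-free form:

* ★★★★ `hasEntireLFunction_of_hasCM` — **`L(E, s)` is entire for every elliptic curve `E/ℚ` with complex multiplication** (all thirteen CM
  `j`-invariants: a CM curve is `ℚ`-isogenous to one with CM by the maximal order; Silverman *Advanced Topics* Ex. 2.12(b), II Cor. 10.5.1) —
  Deuring's theorem over `ℚ`, no modularity;
* `analyticRank_eq_zero_iff_of_hasCM` — `ord_{s=1} L(E, s) = 0 ⟺ L(E, 1) ≠ 0` for CM `E/ℚ` (the continuation makes the order of vanishing honest);
* ★ `analyticRank_baseChange_cmField` — **`ord_{s=1} L(E/K, s) = 2 · ord_{s=1} L(E/ℚ, s)`** for `E` with CM by `𝓞_K` (Artin formalism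
  `L(E/K, s) = L(E, s) L(E^{(d_K)}, s)` and `E ∼ E^{(d_K)}`), unconditional;
* `burungaleTian_iff_cmField_form` — Burungale–Tian's rank-zero `p`-converse for CM curves over `ℚ` (the named fact
  `burungaleTian_analyticRank_eq_zero_of_selmerCorank_eq_zero_of_hasCM`) is EQUIVALENT to its form over the CM field `K` (their Thm. 1.1 as
  printed), and `L_one_ne_zero_of_burungaleTian` — its `L`-value form.

Nothing about BSD is proved here.

## References
* M. Deuring (1953–1957); E. Hecke, Math. Z. 6 (1920), §9. [Hecke1920]
* J. H. Silverman, *Advanced Topics in the Arithmetic of Elliptic Curves* (1994), II Cor. 10.5.1, Exercise 2.12(b). [SilvermanATAEC1994]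
* A. Burungale, Y. Tian, *The even parity Goldfeld conjecture: congruent number elliptic curves* / *p-converse …* (2019–2026), Thm. 1.1,
  Thm. 3.1. [BurungaleTian2026] [BurungaleTian2019]

## Mathlib / tree search
Tree: `DeuringHecke.hasEntireLFunction_of_j_mem_maximalCMJInvariants_holds` (`DeuringHeckeContinuationHolds`),
`hasEntireLFunction_of_hasCM_of_deuringHecke`, `analyticRank_baseChange_cmField_of_deuringHecke`,
`burungaleTian_analyticRank_eq_zero_of_selmerCorank_eq_zero_of_hasCM_of_cmField_of_deuringHecke`, `cmField_form_of_burungaleTian_of_deuringHecke`,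
`L_one_ne_zero_of_burungaleTian_of_deuringHecke` (`BSDSelmerCMPConverseProofs`), `analyticRank_eq_zero_iff_holds`.
-/

noncomputable section

open scoped Classical

namespace Literature.NumberTheory.EllipticCurves

namespace DeuringHecke

open _root_.WeierstrassCurve

/-- ★★★★ **Deuring's theorem over `ℚ`: `L(E, s)` is entire for EVERY elliptic curve `E/ℚ` with complex multiplication** — all thirteen CM
`j`-invariants (the nine maximal orders by `hasEntireLFunction_of_j_mem_maximalCMJInvariants_holds`, the orders of discriminant
`−12, −16, −27, −28` by a `ℚ`-isogeny to the maximal order, `hasEntireLFunction_of_hasCM_of_deuringHecke`); no modularity.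
[cite: SilvermanATAEC1994, II Cor. 10.5.1 and Exercise 2.12(b)] -/
theorem hasEntireLFunction_of_hasCM (W : WeierstrassCurve ℚ) [W.IsElliptic] (hCM : W.HasCM) : W.HasEntireLFunction :=
  hasEntireLFunction_of_hasCM_of_deuringHecke hasEntireLFunction_of_j_mem_maximalCMJInvariants_holds W hCM

/-- **`ord_{s=1} L(E, s) = 0 ⟺ L(E, 1) ≠ 0` for every CM elliptic curve over `ℚ`** (the order of vanishing of the tree's `entireLFunction` is the
honest one once the continuation exists). [cite: SilvermanATAEC1994, II Cor. 10.5.1] -/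
theorem analyticRank_eq_zero_iff_of_hasCM (W : WeierstrassCurve ℚ) [W.IsElliptic] (hCM : W.HasCM) :
    W.analyticRank = 0 ↔ W.entireLFunction 1 ≠ 0 :=
  analyticRank_eq_zero_iff_holds (W := W) (hasEntireLFunction_of_hasCM W hCM)

/-- ★ **`ord_{s=1} L(E/K, s) = 2 · ord_{s=1} L(E/ℚ, s)`** for an elliptic curve `E/ℚ` with CM by the maximal order `𝓞_K` and `K` its CM field
(`IsCMFieldOfJ K j(E)`): Artin formalism `L(E/K, s) = L(E, s) · L(E^{(d_K)}, s)` with `E ∼ E^{(d_K)}`, now unconditional (the continuation of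
`L(E, s)` from the Deuring–Hecke leaf). [cite: BurungaleTian2026, proof of Thm. 1.1 (arXiv p. 6)] -/
theorem analyticRank_baseChange_cmField (W : WeierstrassCurve ℚ) [W.IsElliptic] (hj : W.j ∈ maximalCMJInvariants)
    (K : Type) [Field K] [NumberField K] (hK : IsCMFieldOfJ K W.j) : (W.baseChange K).analyticRank = 2 * W.analyticRank :=
  analyticRank_baseChange_cmField_of_deuringHecke hasEntireLFunction_of_j_mem_maximalCMJInvariants_holds W hj K hK

/-- **Burungale–Tian's Theorem 1.1 over the CM field implies the `ℚ`-form** (the tree's named fact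
`burungaleTian_analyticRank_eq_zero_of_selmerCorank_eq_zero_of_hasCM`), unconditionally in the continuation: trust base `{Thm. 1.1 over K}`
only. [cite: BurungaleTian2026, Thm. 1.1 and its proof (arXiv pp. 1, 6)] -/
theorem burungaleTian_of_cmField_form
    (hBT : ∀ (W : WeierstrassCurve ℚ) [W.IsElliptic], W.j ∈ maximalCMJInvariants →
      ∀ (K : Type) [Field K] [NumberField K], IsCMFieldOfJ K W.j →
        ∀ (p : ℕ) [Fact p.Prime], (W.baseChange K).selmerCorank p = 0 → (W.baseChange K).analyticRank = 0) :
    burungaleTian_analyticRank_eq_zero_of_selmerCorank_eq_zero_of_hasCM :=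
  burungaleTian_analyticRank_eq_zero_of_selmerCorank_eq_zero_of_hasCM_of_cmField_of_deuringHecke hBT
    hasEntireLFunction_of_j_mem_maximalCMJInvariants_holds

/-- **The `ℚ`-form implies Theorem 1.1 over the CM field** for curves descending to `ℚ`. [cite: BurungaleTian2026, Thm. 1.1 and its proof (arXiv pp. 1, 6)] -/
theorem cmField_form_of_burungaleTian (h : burungaleTian_analyticRank_eq_zero_of_selmerCorank_eq_zero_of_hasCM) :
    ∀ (W : WeierstrassCurve ℚ) [W.IsElliptic], W.j ∈ maximalCMJInvariants →
      ∀ (K : Type) [Field K] [NumberField K], IsCMFieldOfJ K W.j →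
        ∀ (p : ℕ) [Fact p.Prime], (W.baseChange K).selmerCorank p = 0 → (W.baseChange K).analyticRank = 0 :=
  cmField_form_of_burungaleTian_of_deuringHecke h hasEntireLFunction_of_j_mem_maximalCMJInvariants_holds

/-- **The two forms of Burungale–Tian's rank-zero `p`-converse for CM curves over `ℚ` are equivalent**, unconditionally.
[cite: BurungaleTian2026, Thm. 1.1 and its proof (arXiv pp. 1, 6)] -/
theorem burungaleTian_iff_cmField_form :
    burungaleTian_analyticRank_eq_zero_of_selmerCorank_eq_zero_of_hasCM ↔
      ∀ (W : WeierstrassCurve ℚ) [W.IsElliptic], W.j ∈ maximalCMJInvariants →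
        ∀ (K : Type) [Field K] [NumberField K], IsCMFieldOfJ K W.j →
          ∀ (p : ℕ) [Fact p.Prime], (W.baseChange K).selmerCorank p = 0 → (W.baseChange K).analyticRank = 0 :=
  ⟨cmField_form_of_burungaleTian, burungaleTian_of_cmField_form⟩

/-- **Burungale–Tian's Theorem 3.1 for `f = f_E` in `L`-value form, below the proved leaf**: for `E/ℚ` with CM and `p` prime, `Sel_{p^∞}(E/ℚ)`
finite ⟹ `L(E, 1) ≠ 0`, granted the named fact `burungaleTian_analyticRank_eq_zero_of_selmerCorank_eq_zero_of_hasCM` only.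
[cite: BurungaleTian2026, Thm. 3.1 and Remark 3.2 (arXiv pp. 5–6)] -/
theorem L_one_ne_zero_of_burungaleTian (h : burungaleTian_analyticRank_eq_zero_of_selmerCorank_eq_zero_of_hasCM)
    (W : WeierstrassCurve ℚ) [W.IsElliptic] (hCM : W.HasCM) (p : ℕ) [Fact p.Prime] (hfin : Finite (selmerGroupPInfty W p)) :
    W.entireLFunction 1 ≠ 0 :=
  L_one_ne_zero_of_burungaleTian_of_deuringHecke h hasEntireLFunction_of_j_mem_maximalCMJInvariants_holds W hCM p hfin

end DeuringHecke

end Literature.NumberTheory.EllipticCurves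

end
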